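import Literature.NumberTheory.LFunctions.ConreyIwaniec2002Prop64Of
import Literature.NumberTheory.LFunctions.ConreyIwaniec2002Prop64Diagonal
import HarnessLib

/-!
# Conrey–Iwaniec (2002), Proposition 6.4 from (6.4)–(6.12), (6.27)–(6.28) and Theorems 4.3–4.4

B. Conrey, H. Iwaniec, Acta Arith. 103 (2002) 259–312, Proposition 6.4 [held text
`paper:arxiv-math_0111012`, p0014–p0017]. With the diagonal (6.51) now a tree theorem
(`prop64_diagonal`, stub S4 of SKELETON P64, line `thm61-cm-convolution`), the typed
`conreyIwaniec2002_proposition64` follows from the three remaining registered stub statements: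
S2a (`∃ c > 0, Thm61Generic c`), S2b (`∃ c > 0, Thm61ShiftedSum c`) and S3 (the shifted-convolution
asymptotics of Theorems 4.3–4.4 for the class-group forms). No claim about Landau–Siegel zeros.

## References
* [ConreyIwaniec2002] B. Conrey, H. Iwaniec, Acta Arith. 103 (2002) 259–312: Proposition 6.4 (6.52).
-/

noncomputable section

open scoped NumberField
open Complex MeasureTheory

namespace Literature.NumberTheory.LFunctions

namespace ConreyIwaniec2002

open NumberField Literature.NumberTheory.LFunctions.NumberField

/-- **Proposition 6.4 from S2a, S2b, S3** (S1, S2c, S4, S5, S6 are tree theorems).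
[cite: ConreyIwaniec2002, Proposition 6.4 (6.52)] -/
theorem proposition64_of_thm61_inputs_and_shiftedConvolution
    (h2a : ∃ c : ℝ, 0 < c ∧ Thm61Generic c) (h2b : ∃ c : ℝ, 0 < c ∧ Thm61ShiftedSum c)
    (h3 :
      ∃ c : ℝ, 0 < c ∧
        ∀ (q : ℕ) [NeZero q], 4 < q → Odd q → ∀ χ : DirichletCharacter ℂ q,
          χ.IsPrimitive → χ.IsQuadratic → χ.Odd →
            ∀ (K : Type) [Field K] [NumberField K],
              Module.finrank ℚ K = 2 → NumberField.discr K = -(q : ℤ) →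
                ∀ (ψ : ClassGroup (𝓞 K) →* ℂˣ),
                  ∃ σ : ℕ → ℝ, IsCISigma q ‖χ.LFunction 1‖ σ ∧
                    ShiftedConvolutionBound (twistCount K (classGroupCharIdealHom ψ)) σ
                      (c * (q : ℝ) ^ (6 : ℕ))) :
    conreyIwaniec2002_proposition64 :=
  proposition64_of_stubs h2a h2b h3 prop64_diagonal

end ConreyIwaniec2002

end Literature.NumberTheory.LFunctions

end
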